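import Summits.HodgeConjecture.HodgeConjecture.Theorems.F0P3cU2PrincipalSeriesJacquetFiltration   -- ★ N1₂ `u2PrincipalSeries_jacquetFiltration` (`dim r_{B₂} i(χ) = 2`, line `wχ`, quotient `χ`)
import Summits.HodgeConjecture.HodgeConjecture.Theorems.F0P3bHPrincipalSeriesJHHolds             -- ★ (H3) `hHC_holds` (constituents of `i(χ)` have `r_{B₂} ≠ 0`)
import Summits.HodgeConjecture.HodgeConjecture.Theorems.F0P3bU2XiQuotientFunctional              -- ★ (H4) `xi_quotient_functional` (the `ξ₂`-quotient functional `q`)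
import Summits.HodgeConjecture.HodgeConjecture.Theorems.F0P3bU2NoCharacterEigenvector             -- ★ (EIG) `no_char_eigenvector_cmPrincipalSeries_two`, `exists_torusU_two_norm_lt_one`
import Summits.HodgeConjecture.HodgeConjecture.Theorems.F0P3bU2XiSphericalVector                 -- ★ `localDet_eq_one_of_mem_N`, `localDet_torus_eq_quotConj`
import Summits.HodgeConjecture.HodgeConjecture.Theorems.F0P3cStCharTSHLevelDeep                  -- ★ `continuous_chiH2_fst`
import Summits.HodgeConjecture.HodgeConjecture.Theorems.F0P3cStCharTSStOneDim                    -- ★ GENERIC `hasJacquetExponent_twist_trivial_of_character`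
import Literature.NumberTheory.Automorphic.ConstituentsPairOfCharacterQuotient                    -- ★ `IrrClass.nonempty_quotientRep_equiv_ofChar_of_eq_ker`, `forall_apply_eq_smul_of_ker_eq_bot`
import Literature.NumberTheory.Automorphic.ConstituentsOfExtension                                -- ★ `isConstituentOf_iff_of_isIrreducible`, `isIrreducible_…_of_forall_not_lt_lt`
import Literature.NumberTheory.Automorphic.JacquetLengthTwoLabels                                 -- ★ `jacquetMap_equiv_injective`, `exact_subtype_mkQ`
import Literature.NumberTheory.Automorphic.JacquetLineExponents                                   -- ★ `finrank_eq_one_and_normalizedJacquet_eq_of_line`, `nonempty_normalizedJacquet_equiv_twist_of_finrank_eq_one`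
import Literature.NumberTheory.Automorphic.UnitaryGroupLineBorelModulus                           -- ★ `rootDeltaChar_cmBorel_torus_two` (`δ_{B₂}^{1∕2}(t) = ‖t₀₀‖^{1∕2}`)
import Literature.NumberTheory.Automorphic.UnitaryGroupBorelRingModulus                           -- ★ `HeisRing.distribHaarChar_map_eq` (`‖σ x‖ = ‖x‖`)
import Literature.NumberTheory.Automorphic.CMXiTorusCharSplitTorusDecay                           -- ★ `quotConj_eq_one_of_map_eq`
import HarnessLib

/-!
# R90-TF ∕ S10 — THE JACQUET CHARACTER OF THE STEINBERG CONSTITUENT OF `i(χH₂)` ON `U(Φ₂)(L⁺_v)`: every constituent `c ≠ ⟦ℂ_{ξ₂}⟧` has normalised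
# Jacquet module `r_{B₂}(c) ≅ χH₂ = (η̃_v‖·‖^{1/2}, ψ_v)` (the DECAYING character) — the orientation input of Casselman's criterion for `St(ξ₂)`
# (`Theorems/R90S10U2SteinbergJacquetLabel.lean`; ns `Summit.HodgeConjecture.HodgeConjecture.R90.S10`; lane `--supports stmt-HodgeConjecture-24833 --as helper`)

Cell `pub/hodgecm-mathlib`, R90-TF SLAB section S10, seat R90-C138-p04 (g0): PHASE 2 of card A1′, brick (B) (the `N = 2` twin of ★ `F0P3cStCharTSStLabels` FILE B for
`U(3)`, reduced to what brick (C) needs).  THEOREMS ONLY — sorry-free, no `def`, no instance, no notation, no named fact; ★-only imports; a short kit (§1) and the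
label (§2).

THE MATHEMATICS ([Rogawski1990, §12.1 case (1) pp. 171–172]; [Casselman1995, §7.1]).  `G₂ = U(Φ₂)(L⁺_v)` at a NON-SPLIT `v`, `B₂ = T₂N₂`, `χ = χH₂ = (χ₁, ψ_v)` with
`χ₁ = (η_v ∘ quotConj)·‖·‖^{1/2}`, `wχ = (χ̄₁⁻¹, ψ_v)` its Weyl conjugate; `ρ = i(χ)` (normalised induction), `ξ₂ = ξ_v ∘ inl = (η_vψ_v) ∘ det₂`.  ★ N1₂: `r_{B₂}(ρ)` is
two-dimensional with a line `ℓ` carrying `wχ` and quotient `χ`.  ★ (H4): a non-zero functional `q` with `q(ρ(g)f) = ξ₂(g) q(f)`; `K := ker q` is `G₂`-stable,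
`K ≠ ⊤` (`q ≠ 0`), `K ≠ ⊥` (else every vector is a `ξ₂`-eigenvector, ★ (EIG)), so by (JH₂)'s «no 3-chains» `ρ|_K` and `ρ ⁄ K ≅ ℂ_{ξ₂}` are irreducible and
`JH(ρ) = {⟦ℂ_{ξ₂}⟧, ⟦ρ|_K⟧}`; hence a constituent `c ≠ ⟦ℂ_{ξ₂}⟧` IS `⟦ρ|_K⟧` (`St(ξ₂)`).  ORIENTATION: `ℂ_{ξ₂}` has the normalised exponent `ξ₂|_{T₂}·δ^{-1/2} = wχ`
(§1 `xiTwo_torus_eq_weylChar_mul_rootDelta`: `ξ₂(t) = wχ(t)·δ_{B₂}^{1/2}(t)`, from `det t = t₀₀ ∕ σt₀₀`, `δ^{1/2}(t) = ‖t₀₀‖^{1/2}`, `‖σx‖ = ‖x‖`), so `ρ ⁄ K` has exponent `wχ`;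
if `ρ|_K` had exponent `wχ` too, its eigenvector would map into `ℓ` (the `wχ`-eigenvectors of `r(ρ)` lie in `ℓ` as `wχ ≠ χ`), forcing `ℓ ⊆ ker(r(ρ) → r(ρ⁄K))` and
`r(ρ ⁄ K) ≅ r(ρ)∕ℓ = χ`, contradicting `wχ ≠ χ` (§1 `weylChar_ne_chiH2`: at `t = d(a, a⁻¹)`, `σa = a`, `‖a‖ < 1`, `|χ(t)| = ‖a‖^{1/2} ≠ ‖a‖^{-1/2} = |wχ(t)|`).  So `wχ` is
NOT an exponent of `ρ|_K`, and ★ `finrank_eq_one_and_normalizedJacquet_eq_of_line` (exactness of `r_{B₂}` ★ `jacquet_exact_holds`, `r(ρ|_K) ≠ 0` by Frobenius ★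
`nontrivial_coinvariants_of_injective_normalizedInd`) gives `r(ρ|_K)` = a LINE on which `T₂` acts by `χ`, i.e. `r_{B₂}(St(ξ₂)) ≅ χH₂` (★
`nonempty_normalizedJacquet_equiv_twist_of_finrank_eq_one`).  CONSUMER: brick (C) `R90S10U2SteinbergSquareIntegrable` feeds this to brick (A) ★-cand
`isSquareIntegrable_of_jacquet_decays_two` (`‖χH₂(t)‖ = ‖t₀₀‖^{1/2} < 1` on the contracting torus).
HONEST LABEL: helper, pays no socket by itself; HC_CM is proved only modulo the 7 printed citations (2 remaining named inputs: hLiu418 = `stmt-HodgeConjecture-24832`,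
h413 = `stmt-HodgeConjecture-24833`) until rung 0 closes; REL ≠ ★ ≠ BUILT; count-neutral.

## References
* [Rogawski1990] J. D. Rogawski, *Automorphic Representations of Unitary Groups in Three Variables*, Ann. of Math. Stud. 123 (1990), §12.1 case (1) pp. 171–172; §12.2 p. 173.
* [Casselman1995] W. Casselman, *Introduction to the theory of admissible representations of `p`-adic reductive groups* (draft 1995), L. 7.1.1 (a), Cor. 7.1.2, Prop. 7.1.3 p. 67;
  §3.2 p. 37; §4.4 p. 45.
* [BernsteinZelevinsky1977] I. N. Bernstein, A. V. Zelevinsky, *Induced representations of reductive 𝔭-adic groups I*, Ann. Sci. ÉNS 10 (1977), §2.3, Cor. 2.13.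
-/

set_option autoImplicit false
set_option linter.dupNamespace false

noncomputable section

open NumberField IsDedekindDomain MeasureTheory
open scoped Matrix MatrixGroups NNReal
open Literature.NumberTheory.Rogawski1990 Literature.NumberTheory.Automorphic Literature.NumberTheory.Automorphic.UnitaryGroup
open Literature.NumberTheory.GaloisRepresentations
open Literature.RepresentationTheory.FiniteGroups Literature.RepresentationTheory.Semisimple

namespace Summit.HodgeConjecture.HodgeConjecture.R90.S10

open Summit.HodgeConjecture.HodgeConjecture.Cruxes.H413

variable (L : Type) [Field L] [NumberField L] [IsCMField L] (v : HeightOneSpectrum (𝓞 ↥(maximalRealSubfield L)))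

/-! ## §1 Kit: `σ`-symmetries of `quotConj` ∕ `‖·‖^{1/2}`, `wχ ≠ χ`, and the dictionary `ξ₂|_{T₂} = wχ · δ^{1/2}` -/

/-- `quotConj (σ x) = (quotConj x)⁻¹` (`quotConj x = x ∕ σx`, `σ` an involution). [cite: Rogawski1990, §12.1 p. 172] -/
theorem quotConj_map_conjLocal (x : (LocalRing L v)ˣ) :
    quotConj (conjLocal L (IsCMField.complexConj L) v) (conjLocal_conjLocal_cm L v)
        (Units.map (conjLocal L (IsCMField.complexConj L) v : LocalRing L v →* LocalRing L v) x) =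
      (quotConj (conjLocal L (IsCMField.complexConj L) v) (conjLocal_conjLocal_cm L v) x)⁻¹ := by
  apply Subtype.ext
  have hσσ : Units.map (conjLocal L (IsCMField.complexConj L) v : LocalRing L v →* LocalRing L v)
      (Units.map (conjLocal L (IsCMField.complexConj L) v : LocalRing L v →* LocalRing L v) x) = x :=
    Units.ext (conjLocal_conjLocal_cm L v (x : LocalRing L v))
  rw [coe_quotConj, hσσ, Subgroup.coe_inv, coe_quotConj, mul_inv_rev, inv_inv]

/-- `‖σ x‖^{1/2} = ‖x‖^{1/2}` (★ `HeisRing.distribHaarChar_map_eq`: `‖σ x‖ = ‖x‖`). [cite: Rogawski1990, §12.2 p. 173] -/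
theorem halfModulusChar_map_conjLocal (x : (LocalRing L v)ˣ) :
    halfModulusChar (LocalRing L v) (Units.map (conjLocal L (IsCMField.complexConj L) v : LocalRing L v →* LocalRing L v) x) =
      halfModulusChar (LocalRing L v) x := by
  letI : MeasurableSpace (LocalRing L v) := borel _
  haveI : BorelSpace (LocalRing L v) := ⟨rfl⟩
  refine Units.ext ?_
  rw [coe_halfModulusChar_apply, coe_halfModulusChar_apply]
  have h : unitModulusChar (LocalRing L v) (Units.map (conjLocal L (IsCMField.complexConj L) v : LocalRing L v →* LocalRing L v) x) =
      unitModulusChar (LocalRing L v) x :=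
    HeisRing.distribHaarChar_map_eq (conjLocal L (IsCMField.complexConj L) v) (conjLocal_conjLocal_cm L v)
      (continuous_conjLocal L (IsCMField.complexConj L) v) x
  rw [h]

/-- **`wχH₂ ≠ χH₂`**: at a split-torus element `t = d(a, a⁻¹)` with `σa = a`, `‖a‖ < 1` (★ `exists_torusU_two_norm_lt_one`), `χ₁(σa)⁻¹ = χ₁(a)⁻¹` while an
equality of the pairs would give `χ₁(a)⁻¹ = χ₁(a)`, i.e. `‖a‖^{1/2} · ‖a‖^{1/2} = 1` (`η_v(quotConj a) = 1` as `quotConj a = 1`). [cite: Rogawski1990, §12.1 p. 171; §12.2 p. 173]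
[cite: Casselman1995, §7.1 p. 67] -/
theorem weylChar_ne_chiH2 (ξ : OneDimAutRepH L) :
    weylTorusCharPair (conjLocal L (IsCMField.complexConj L) v) (cmLocalForm L 2 v) (cmLocalForm_eq_over L 2 v) 0
        ((torusLocalComponent L (IsCMField.complexConj L) v ξ.η).comp
            (quotConj (conjLocal L (IsCMField.complexConj L) v) (conjLocal_conjLocal_cm L v)) *
          halfModulusChar (UnitaryGroup.LocalRing L v))
        (torusLocalComponent L (IsCMField.complexConj L) v ξ.ψ) ≠
      torusCharPair (conjLocal L (IsCMField.complexConj L) v) (cmLocalForm L 2 v) (cmLocalForm_eq_over L 2 v) 0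
        ((torusLocalComponent L (IsCMField.complexConj L) v ξ.η).comp
            (quotConj (conjLocal L (IsCMField.complexConj L) v) (conjLocal_conjLocal_cm L v)) *
          halfModulusChar (UnitaryGroup.LocalRing L v))
        (torusLocalComponent L (IsCMField.complexConj L) v ξ.ψ) := by
  intro heq
  obtain ⟨t, d, hd, hσ, hlt, -⟩ := F0P3bU2NoCharacterEigenvector.exists_torusU_two_norm_lt_one L v
  have h := DFunLike.congr_fun heq t
  rw [weylTorusCharPair_apply, torusCharPair_apply, torusEntry_eq_of_glDiagonal_eq _ _ 0 t d hd] at h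
  have hσd : Units.map (conjLocal L (IsCMField.complexConj L) v : LocalRing L v →* LocalRing L v) (d 0) = d 0 := Units.ext hσ
  rw [hσd] at h
  have h1 := mul_right_cancel h
  -- `χ₁(d₀) = ‖d₀‖^{1/2}` as a complex number (`quotConj d₀ = 1`)
  have hq1 : quotConj (conjLocal L (IsCMField.complexConj L) v) (conjLocal_conjLocal_cm L v) (d 0) = 1 :=
    quotConj_eq_one_of_map_eq _ (conjLocal_conjLocal_cm L v) (d 0) hσ
  have hval : ((((torusLocalComponent L (IsCMField.complexConj L) v ξ.η).comp
      (quotConj (conjLocal L (IsCMField.complexConj L) v) (conjLocal_conjLocal_cm L v)) *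
        halfModulusChar (UnitaryGroup.LocalRing L v)) (d 0) : ℂˣ) : ℂ) = ((NNReal.sqrt (unitModulusChar (LocalRing L v) (d 0)) : ℝ≥0) : ℝ) := by
    rw [MonoidHom.mul_apply, MonoidHom.comp_apply, hq1, map_one, one_mul, coe_halfModulusChar_apply]
  -- `χ₁(d₀)⁻¹ = χ₁(d₀)` gives `χ₁(d₀)² = 1`, i.e. `‖d₀‖ = 1`
  have h2 : ((((torusLocalComponent L (IsCMField.complexConj L) v ξ.η).comp
      (quotConj (conjLocal L (IsCMField.complexConj L) v) (conjLocal_conjLocal_cm L v)) *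
        halfModulusChar (UnitaryGroup.LocalRing L v)) (d 0) : ℂˣ) : ℂ) ^ 2 = 1 := by
    have h3 := congrArg (fun u : ℂˣ => (u : ℂ)) h1
    simp only [Units.val_inv_eq_inv_val] at h3
    have hne : ((((torusLocalComponent L (IsCMField.complexConj L) v ξ.η).comp
        (quotConj (conjLocal L (IsCMField.complexConj L) v) (conjLocal_conjLocal_cm L v)) *
          halfModulusChar (UnitaryGroup.LocalRing L v)) (d 0) : ℂˣ) : ℂ) ≠ 0 := Units.ne_zero _
    have h4 := mul_inv_cancel₀ hne
    rw [h3] at h4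
    rw [sq]
    exact h4
  rw [hval, ← Complex.ofReal_pow, ← NNReal.coe_pow, NNReal.sq_sqrt, Complex.ofReal_eq_one, NNReal.coe_eq_one] at h2
  exact (ne_of_lt hlt) h2

set_option synthInstance.maxHeartbeats 400000 in
set_option maxHeartbeats 1600000 in
/-- **THE DICTIONARY ON `T₂`: `ξ₂(t) = wχH₂(t) · δ_{B₂}^{1/2}(t)`** (`ξ₂ = (η_vψ_v) ∘ det₂`, `det t = quotConj t₀₀` ★ `localDet_torus_eq_quotConj`, `δ^{1/2}(t) = ‖t₀₀‖^{1/2}` ★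
`rootDeltaChar_cmBorel_torus_two`, `quotConj(σx) = (quotConj x)⁻¹`, `‖σx‖ = ‖x‖`) — the `hχ` input of ★ `hasJacquetExponent_twist_trivial_of_character`: the normalised Jacquet
exponent of `ℂ_{ξ₂}` along `B₂` is `wχH₂`. [cite: Rogawski1990, §12.1 p. 171] [cite: Casselman1995, §3.2 p. 37] -/
theorem xiTwo_torus_eq_weylChar_mul_rootDelta (ξ : OneDimAutRepH L) (m : ↥(cmBorelTriple L 2 v).M) :
    haveI := locallyCompactSpace_cmBorelU L 2 v
    ((torusLocalComponent L (IsCMField.complexConj L) v ξ.η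
          (localDet (IsCMField.complexConj L) v (isUnit_antidiagOne_det L 2)
            (m : ↥(unitaryGroupOfForm (conjLocal L (IsCMField.complexConj L) v) (cmLocalForm L 2 v)))) *
        torusLocalComponent L (IsCMField.complexConj L) v ξ.ψ
          (localDet (IsCMField.complexConj L) v (isUnit_antidiagOne_det L 2)
            (m : ↥(unitaryGroupOfForm (conjLocal L (IsCMField.complexConj L) v) (cmLocalForm L 2 v)))) : ℂˣ) : ℂ) =
      ((weylTorusCharPair (conjLocal L (IsCMField.complexConj L) v) (cmLocalForm L 2 v) (cmLocalForm_eq_over L 2 v) 0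
            ((torusLocalComponent L (IsCMField.complexConj L) v ξ.η).comp
                (quotConj (conjLocal L (IsCMField.complexConj L) v) (conjLocal_conjLocal_cm L v)) *
              halfModulusChar (UnitaryGroup.LocalRing L v))
            (torusLocalComponent L (IsCMField.complexConj L) v ξ.ψ) m : ℂˣ) : ℂ) *
        ((rootDeltaChar (cmBorelTriple L 2 v).P (Subgroup.inclusion (cmBorelTriple L 2 v).M_le m) : ℂˣ) : ℂ) := by
  haveI := locallyCompactSpace_cmBorelU L 2 v
  have hdet : localDet (IsCMField.complexConj L) v (isUnit_antidiagOne_det L 2)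
      (J := Matrix.of fun i j : Fin 2 => if i.val + j.val + 1 = 2 then (1 : L) else 0)
      (m : ↥(unitaryGroupOfForm (conjLocal L (IsCMField.complexConj L) v) (cmLocalForm L 2 v))) =
      quotConj (conjLocal L (IsCMField.complexConj L) v) (conjLocal_conjLocal_cm L v)
        (torusEntry (conjLocal L (IsCMField.complexConj L) v) (cmLocalForm L 2 v) 0 m) :=
    F0P3bU2XiSphericalVector.localDet_torus_eq_quotConj L v m
  have hdet' : torusDetNormOne (conjLocal L (IsCMField.complexConj L) v) (cmLocalForm L 2 v) (cmLocalForm_eq_over L 2 v) m =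
      localDet (IsCMField.complexConj L) v (isUnit_antidiagOne_det L 2)
        (J := Matrix.of fun i j : Fin 2 => if i.val + j.val + 1 = 2 then (1 : L) else 0)
        (m : ↥(unitaryGroupOfForm (conjLocal L (IsCMField.complexConj L) v) (cmLocalForm L 2 v))) :=
    Subtype.ext (Units.ext rfl)
  have hδ : rootDeltaChar (cmBorelTriple L 2 v).P (Subgroup.inclusion (cmBorelTriple L 2 v).M_le m) =
      halfModulusChar (LocalRing L v) (torusEntry (conjLocal L (IsCMField.complexConj L) v) (cmLocalForm L 2 v) 0 m) :=
    rootDeltaChar_cmBorel_torus_two L v m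
  rw [hδ, weylTorusCharPair_apply, hdet', hdet, MonoidHom.mul_apply, MonoidHom.comp_apply, quotConj_map_conjLocal,
    halfModulusChar_map_conjLocal, map_inv]
  have hh : ((halfModulusChar (LocalRing L v) (torusEntry (conjLocal L (IsCMField.complexConj L) v) (cmLocalForm L 2 v) 0 m) : ℂˣ) : ℂ) ≠ 0 :=
    Units.ne_zero _
  simp only [Units.val_mul, Units.val_inv_eq_inv_val, mul_inv_rev, inv_inv]
  field_simp

/-! ## §1b Generic: the sub of a length-two representation whose quotient carries the LINE character carries the QUOTIENT character -/

/-- **GENERIC ORIENTATION LEMMA.**  `t = (P, M, N)` a parabolic triple with `N` a union of compact open subgroups, `ρ` smooth with `r_P(ρ)` two-dimensional carrying a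
stable line `ℓ` (character `θ₁`) with quotient character `θ₂ ≠ θ₁`, `K ≤ ρ` a subrepresentation with `dim r_P(ρ ⁄ K) ≤ 1` (so `r_P(ρ|_K) ≠ 0` by exactness)
whose QUOTIENT `ρ ⁄ K` has `θ₁` as an exponent.
Then `r_P(ρ|_K)` is a line on which `M` acts by `θ₂`: `r_P(ρ|_K) ≅ ℂ_{θ₂}`.  Proof: if `ρ|_K` had a `θ₁`-eigenvector `w`, its image in `r(ρ)` would be a `θ₁`-eigenvector,
hence in `ℓ` (`θ₁ ≠ θ₂` at some `m₀`), so `ℓ = ℂ·w ⊆ ker(r(ρ) → r(ρ⁄K))` (exactness ★ `jacquet_exact_holds`); lifting a `θ₁`-eigenvector of `r(ρ ⁄ K)` to `u ∈ r(ρ)`,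
`r(m₀)u − θ₂(m₀)u ∈ ℓ` maps to `(θ₁(m₀) − θ₂(m₀))·z = 0`, absurd; so `θ₁` is not an exponent of `ρ|_K` and ★ `finrank_eq_one_and_normalizedJacquet_eq_of_line` ∕ ★
`nonempty_normalizedJacquet_equiv_twist_of_finrank_eq_one` conclude. [cite: Casselman1995, L. 7.1.1 (a), Cor. 7.1.2, Prop. 7.1.3 p. 67] [cite: BernsteinZelevinsky1977, §2.3, Cor. 2.13] -/
theorem nonempty_normalizedJacquet_sub_equiv_of_quotient_exponent {G : Type*} [Group G] [TopologicalSpace G] [IsTopologicalGroup G]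
    (t : ParabolicTriple G) [LocallyCompactSpace ↥t.P] (hNlim : IsLimitOfCompactOpen t.N)
    {V : Type*} [AddCommGroup V] [Module ℂ V] {ρ : Representation ℂ G V} (hρ : ρ.IsSmooth) (K : Subrepresentation ρ)
    [FiniteDimensional ℂ (t.restrict K.quotientRep).Coinvariants] (hQ1 : Module.finrank ℂ (t.restrict K.quotientRep).Coinvariants ≤ 1)
    {θ₁ θ₂ : ↥t.M →* ℂˣ} (hne : θ₁ ≠ θ₂)
    [FiniteDimensional ℂ (t.restrict ρ).Coinvariants] (h2 : Module.finrank ℂ (t.restrict ρ).Coinvariants = 2)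
    (ℓ : Submodule ℂ (t.restrict ρ).Coinvariants) (hℓ1 : Module.finrank ℂ ↥ℓ = 1)
    (hℓ : ∀ (m : ↥t.M), ∀ x ∈ ℓ, ρ.normalizedJacquet t m x = ((θ₁ m : ℂˣ) : ℂ) • x)
    (hq : ∀ (m : ↥t.M) (x : (t.restrict ρ).Coinvariants), ρ.normalizedJacquet t m x - ((θ₂ m : ℂˣ) : ℂ) • x ∈ ℓ)
    (hX : K.quotientRep.HasJacquetExponent t θ₁) :
    Nonempty ((K.toRepresentation.normalizedJacquet t).Equiv ((Representation.trivial ℂ ↥t.M ℂ).twist θ₂)) := by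
  -- exactness of `r_P` along `0 → K → ρ → ρ ⁄ K → 0`
  obtain ⟨hJinj, hJex, hJsurj⟩ := Representation.jacquet_exact_holds (k := ℂ) t hNlim (hρ.toRepresentation K) hρ
    (hρ.quotientRep K) (Subrepresentation.subtypeIntertwiningMap K) K.mkQ (Subrepresentation.subtypeIntertwiningMap_injective K)
    (IrrClass.exact_subtype_mkQ K) K.mkQ_surjective
  -- rank bookkeeping: `2 = dim r(K) + dim r(ρ ⁄ K)`, so `r(K) ≠ 0`
  haveI : FiniteDimensional ℂ (t.restrict K.toRepresentation).Coinvariants :=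
    Module.Finite.of_injective (Representation.jacquetMap t (Subrepresentation.subtypeIntertwiningMap K)).toLinearMap hJinj
  haveI : Nontrivial (t.restrict K.toRepresentation).Coinvariants := by
    have hrn := LinearMap.finrank_range_add_finrank_ker (Representation.jacquetMap t K.mkQ).toLinearMap
    have hrange : Module.finrank ℂ ↥(LinearMap.range (Representation.jacquetMap t K.mkQ).toLinearMap) =
        Module.finrank ℂ (t.restrict K.quotientRep).Coinvariants := by
      rw [LinearMap.range_eq_top.2 hJsurj, finrank_top]
    have hker : Module.finrank ℂ ↥(LinearMap.ker (Representation.jacquetMap t K.mkQ).toLinearMap) =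
        Module.finrank ℂ (t.restrict K.toRepresentation).Coinvariants := by
      rw [LinearMap.exact_iff.1 hJex]
      exact LinearMap.finrank_range_of_inj hJinj
    rw [hrange, hker, h2] at hrn
    exact Module.nontrivial_of_finrank_pos (R := ℂ) (by omega)
  -- `θ₁` is NOT an exponent of `ρ|_K`
  have hno : ¬ K.toRepresentation.HasJacquetExponent t θ₁ := by
    rintro ⟨w, hw0, hw⟩
    obtain ⟨m₀, hm₀⟩ : ∃ m₀ : ↥t.M, ((θ₁ m₀ : ℂˣ) : ℂ) ≠ ((θ₂ m₀ : ℂˣ) : ℂ) := by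
      by_contra hall
      push Not at hall
      exact hne (MonoidHom.ext fun m => Units.ext (hall m))
    have hy0 : Representation.jacquetMap t (Subrepresentation.subtypeIntertwiningMap K) w ≠ 0 := fun h => hw0 (hJinj (by rw [h, map_zero]))
    have hy : ∀ m, ρ.normalizedJacquet t m (Representation.jacquetMap t (Subrepresentation.subtypeIntertwiningMap K) w) =
        ((θ₁ m : ℂˣ) : ℂ) • Representation.jacquetMap t (Subrepresentation.subtypeIntertwiningMap K) w := fun m => by
      rw [← Representation.jacquetMap_normalizedJacquet, hw m, map_smul]
    have hyℓ : Representation.jacquetMap t (Subrepresentation.subtypeIntertwiningMap K) w ∈ ℓ := by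
      have h := hq m₀ (Representation.jacquetMap t (Subrepresentation.subtypeIntertwiningMap K) w)
      rw [hy m₀, ← sub_smul] at h
      exact (Submodule.smul_mem_iff ℓ (sub_ne_zero.2 hm₀)).1 h
    -- `ℓ = ℂ · w ⊆ ker(r(ρ) → r(ρ ⁄ K))`
    have hℓG : ∀ x ∈ ℓ, Representation.jacquetMap t K.mkQ x = 0 := by
      intro x hx
      haveI : FiniteDimensional ℂ ↥ℓ := Module.finite_of_finrank_eq_succ hℓ1
      obtain ⟨a, ha⟩ := (finrank_eq_one_iff_of_nonzero' (⟨_, hyℓ⟩ : ↥ℓ) (fun h => hy0 (congrArg Subtype.val h))).1 hℓ1 ⟨x, hx⟩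
      have hxa : x = a • Representation.jacquetMap t (Subrepresentation.subtypeIntertwiningMap K) w := by
        have := congrArg Subtype.val ha
        simpa using this.symm
      have hGF : Representation.jacquetMap t K.mkQ (Representation.jacquetMap t (Subrepresentation.subtypeIntertwiningMap K) w) = 0 :=
        (hJex _).2 ⟨w, rfl⟩
      rw [hxa, map_smul, hGF, smul_zero]
    -- a `θ₁`-eigenvector of `r(ρ ⁄ K)` lifts to `u` with `r(m₀)u − θ₂(m₀)u ∈ ℓ`: absurd
    obtain ⟨z, hz0, hz⟩ := hX
    obtain ⟨u, rfl⟩ := hJsurj z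
    have h4 := hℓG _ (hq m₀ u)
    rw [map_sub, map_smul, Representation.jacquetMap_normalizedJacquet, hz m₀, ← sub_smul] at h4
    exact hz0 ((smul_eq_zero.1 h4).resolve_left (sub_ne_zero.2 hm₀))
  obtain ⟨h1K, hactK⟩ := Representation.finrank_eq_one_and_normalizedJacquet_eq_of_line t
    (Subrepresentation.subtypeIntertwiningMap K) hJinj h2 ℓ hℓ1 hℓ hq hno
  exact Representation.nonempty_normalizedJacquet_equiv_twist_of_finrank_eq_one t h1K hactK

/-! ## §2 The Jacquet character of the Steinberg constituent -/

set_option synthInstance.maxHeartbeats 400000 in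
set_option maxHeartbeats 8000000 in  -- the `cmPrincipalSeries = normalizedInd` rfl-bridges on the CM carrier (as ★ N1₂, 8 M)
/-- **`r_{B₂}(St(ξ₂)) ≅ χH₂`.**  At a NON-SPLIT `v`, for a one-dimensional `ξ = (η, ψ)`, for any character `Ξ` of `U(Φ₂)(L⁺_v)` with open kernel taking the values
`Ξ(g) = η_v(det g)·ψ_v(det g)` (the consumer's `ξ₂ = ξ_v ∘ inl`, ★ `xiLocalChar_apply_eq`): every constituent `c ≠ ⟦ℂ_Ξ⟧` of `i(χH₂) = cmPrincipalSeries L 2 v (η̃_v‖·‖^{1/2}, ψ_v)` has a representative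
whose normalised Jacquet module along `B₂` is `M`-isomorphic to the character `χH₂` itself (NOT to its Weyl conjugate).  Proof: module docstring.
[cite: Rogawski1990, §12.1 case (1) pp. 171–172] [cite: Casselman1995, L. 7.1.1 (a), Cor. 7.1.2, Prop. 7.1.3 p. 67] -/
theorem exists_normalizedJacquet_equiv_chiH2_of_ne_ofChar (hns : ∀ w : PlacesOver L v, IsCMField.complexConj L • w.1 = w.1) (ξ : OneDimAutRepH L)
    (Ξ : ↥(unitaryGroupOfForm (conjLocal L (IsCMField.complexConj L) v) (cmLocalForm L 2 v)) →* ℂˣ)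
    (hΞ : IsOpen ((Ξ.ker : Subgroup ↥(unitaryGroupOfForm (conjLocal L (IsCMField.complexConj L) v) (cmLocalForm L 2 v))) :
      Set ↥(unitaryGroupOfForm (conjLocal L (IsCMField.complexConj L) v) (cmLocalForm L 2 v))))
    (hΞv : ∀ g : ↥(unitaryGroupOfForm (conjLocal L (IsCMField.complexConj L) v) (cmLocalForm L 2 v)),
      Ξ g = torusLocalComponent L (IsCMField.complexConj L) v ξ.η (localDet (IsCMField.complexConj L) v (isUnit_antidiagOne_det L 2) g) *
        torusLocalComponent L (IsCMField.complexConj L) v ξ.ψ (localDet (IsCMField.complexConj L) v (isUnit_antidiagOne_det L 2) g))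
    (c : IrrClass ↥(unitaryGroupOfForm (conjLocal L (IsCMField.complexConj L) v) (cmLocalForm L 2 v)))
    (hc : c.IsConstituentOf (haveI := locallyCompactSpace_cmBorelU L 2 v; cmPrincipalSeries L 2 v
      (torusCharPair (conjLocal L (IsCMField.complexConj L) v) (cmLocalForm L 2 v) (cmLocalForm_eq_over L 2 v) 0
        ((torusLocalComponent L (IsCMField.complexConj L) v ξ.η).comp
            (quotConj (conjLocal L (IsCMField.complexConj L) v) (conjLocal_conjLocal_cm L v)) *
          halfModulusChar (UnitaryGroup.LocalRing L v))
        (torusLocalComponent L (IsCMField.complexConj L) v ξ.ψ))))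
    (hne : c ≠ IrrClass.mk (SmoothIrrep.ofChar Ξ hΞ)) :
    haveI := locallyCompactSpace_cmBorelU L 2 v
    ∃ r : SmoothIrrep ↥(unitaryGroupOfForm (conjLocal L (IsCMField.complexConj L) v) (cmLocalForm L 2 v)), IrrClass.mk r = c ∧
      Nonempty ((r.ρ.normalizedJacquet (cmBorelTriple L 2 v)).Equiv
        ((Representation.trivial ℂ ↥(torusU (conjLocal L (IsCMField.complexConj L) v) (cmLocalForm L 2 v)) ℂ).twist
          (torusCharPair (conjLocal L (IsCMField.complexConj L) v) (cmLocalForm L 2 v) (cmLocalForm_eq_over L 2 v) 0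
            ((torusLocalComponent L (IsCMField.complexConj L) v ξ.η).comp
                (quotConj (conjLocal L (IsCMField.complexConj L) v) (conjLocal_conjLocal_cm L v)) *
              halfModulusChar (UnitaryGroup.LocalRing L v))
            (torusLocalComponent L (IsCMField.complexConj L) v ξ.ψ)))) := by
  haveI := locallyCompactSpace_cmBorelU L 2 v
  -- N1₂: the line data of `r_{B₂} i(χH₂)`
  have H1 := F0P3cU2PrincipalSeriesJacquetFiltration.u2PrincipalSeries_jacquetFiltration L v hns _ _
    (F0P3cStCharTSHLevelDeep.continuous_chiH2_fst L v ξ) (continuous_torusLocalComponent L (IsCMField.complexConj L) (v := v) ξ.ψ)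
  obtain ⟨hfd, h2, ℓ, hℓ1, hℓ, hq⟩ := H1
  haveI := hfd
  -- (H4): the `Ξ`-quotient functional `q` (values rewritten through the dictionary `hΞv`)
  obtain ⟨q, hq0, hqG⟩ := F0P3bU2XiQuotientFunctional.xi_quotient_functional L v ξ hns
  have hq' : ∀ (g : ↥(unitaryGroupOfForm (conjLocal L (IsCMField.complexConj L) v) (cmLocalForm L 2 v))) (f : _),
      q (cmPrincipalSeries L 2 v
          (torusCharPair (conjLocal L (IsCMField.complexConj L) v) (cmLocalForm L 2 v) (cmLocalForm_eq_over L 2 v) 0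
            ((torusLocalComponent L (IsCMField.complexConj L) v ξ.η).comp
                (quotConj (conjLocal L (IsCMField.complexConj L) v) (conjLocal_conjLocal_cm L v)) *
              halfModulusChar (UnitaryGroup.LocalRing L v))
            (torusLocalComponent L (IsCMField.complexConj L) v ξ.ψ)) g f) = ((Ξ g : ℂˣ) : ℂ) * q f :=
    fun g f => (hqG g f).trans (congrArg (fun u : ℂˣ => (u : ℂ) * q f) (hΞv g).symm)
  -- the principal series is smooth; `N₂` is a union of compact open subgroups; `δ_{B₂} = 1` on `N₂`
  have hρ : (cmPrincipalSeries L 2 v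
      (torusCharPair (conjLocal L (IsCMField.complexConj L) v) (cmLocalForm L 2 v) (cmLocalForm_eq_over L 2 v) 0
        ((torusLocalComponent L (IsCMField.complexConj L) v ξ.η).comp
            (quotConj (conjLocal L (IsCMField.complexConj L) v) (conjLocal_conjLocal_cm L v)) *
          halfModulusChar (UnitaryGroup.LocalRing L v))
        (torusLocalComponent L (IsCMField.complexConj L) v ξ.ψ))).IsSmooth :=
    Representation.isSmooth_smoothInd (cmBorelTriple L 2 v).P _
  have hNlim := isLimitOfCompactOpen_cmBorelTriple_N L 2 v
  have hδ := deltaChar_cmBorelTriple_eq_one_of_mem_N L 2 v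
  -- `K = ker q` as a subrepresentation
  obtain ⟨K, hK⟩ : ∃ K : Subrepresentation (cmPrincipalSeries L 2 v
      (torusCharPair (conjLocal L (IsCMField.complexConj L) v) (cmLocalForm L 2 v) (cmLocalForm_eq_over L 2 v) 0
        ((torusLocalComponent L (IsCMField.complexConj L) v ξ.η).comp
            (quotConj (conjLocal L (IsCMField.complexConj L) v) (conjLocal_conjLocal_cm L v)) *
          halfModulusChar (UnitaryGroup.LocalRing L v))
        (torusLocalComponent L (IsCMField.complexConj L) v ξ.ψ))), K.toSubmodule = LinearMap.ker q :=
    ⟨⟨LinearMap.ker q, fun g f hf => by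
      rw [LinearMap.mem_ker] at hf ⊢
      rw [hq', hf, mul_zero]⟩, rfl⟩
  have hKq : ∀ f, f ∈ K ↔ q f = 0 := fun f => by
    rw [← LinearMap.mem_ker, ← hK]; rfl
  have hKtop : K ≠ ⊤ := by
    intro hKt
    obtain ⟨f, hf⟩ := hq0
    have hmem : f ∈ K := by rw [hKt]; trivial
    exact hf ((hKq f).1 hmem)
  have hKbot : K ≠ ⊥ := by
    intro hKb
    obtain ⟨f, hf⟩ := hq0
    have hker : LinearMap.ker q = ⊥ := by rw [← hK, hKb]; rfl
    have hf0 : f = 0 := F0P3bU2NoCharacterEigenvector.no_char_eigenvector_cmPrincipalSeries_two L v ξ hns f fun g =>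
      (IrrClass.forall_apply_eq_smul_of_ker_eq_bot Ξ q hq' hker f g).trans (congrArg (fun u : ℂˣ => (u : ℂ) • f) (hΞv g))
    exact hf (by rw [hf0, map_zero])
  -- (H3) + H1′: no `3`-chains, so `ρ|_K` and `ρ ⁄ K` are irreducible
  have hlen := Representation.not_bot_lt_lt_lt_top_of_finrank_coinvariants_le_two (cmBorelTriple L 2 v) hNlim hρ
    (F0P3bHPrincipalSeriesJHHolds.hHC_holds L v hns _) h2.le
  have hKirr := IrrClass.isIrreducible_toRepresentation_of_forall_not_lt_lt hlen hKbot hKtop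
  have hQirr := IrrClass.isIrreducible_quotientRep_of_forall_not_lt_lt hlen hKbot hKtop
  -- `ρ ⁄ K ≅ ℂ_Ξ`, hence `c = ⟦ρ|_K⟧`
  obtain ⟨eQ⟩ := IrrClass.nonempty_quotientRep_equiv_ofChar_of_eq_ker _ hΞ q hq' hq0 K hK
  have hVK := IrrClass.mk_eq_mk_of_equiv
    (r₁ := SmoothIrrep.mk _ K.quotientRep hQirr (hρ.quotientRep K)) (r₂ := SmoothIrrep.ofChar _ hΞ) eQ
  have hcK : c = IrrClass.mk (SmoothIrrep.mk ↥K.toSubmodule K.toRepresentation hKirr (hρ.toRepresentation K)) := by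
    rcases (IrrClass.isConstituentOf_iff_of_isIrreducible hρ K hKirr hQirr c).1 hc with h | h
    · exact absurd (h.trans hVK) hne
    · exact h
  refine ⟨SmoothIrrep.mk ↥K.toSubmodule K.toRepresentation hKirr (hρ.toRepresentation K), hcK.symm, ?_⟩
  -- `dim r(ρ ⁄ K) ≤ 1`: `r(ρ ⁄ K) ↪ r(ℂ_Ξ)` (along `eQ`), and `r(ℂ_Ξ)` is a quotient of the line `ℂ`
  have hinjQ := IrrClass.jacquetMap_equiv_injective (cmBorelTriple L 2 v) eQ
  haveI : Module.Finite ℂ (SmoothIrrep.ofChar Ξ hΞ).V := Module.Finite.self ℂ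
  have hC1 : Module.finrank ℂ ((cmBorelTriple L 2 v).restrict (SmoothIrrep.ofChar Ξ hΞ).ρ).Coinvariants ≤ 1 := by
    have h := LinearMap.finrank_range_le (Representation.Coinvariants.mk ((cmBorelTriple L 2 v).restrict (SmoothIrrep.ofChar Ξ hΞ).ρ))
    rw [LinearMap.range_eq_top.2 (Representation.Coinvariants.mk_surjective _), finrank_top] at h
    exact h.trans (Module.finrank_self ℂ).le
  haveI : FiniteDimensional ℂ ((cmBorelTriple L 2 v).restrict (SmoothIrrep.ofChar Ξ hΞ).ρ).Coinvariants :=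
    Module.Finite.of_surjective (Representation.Coinvariants.mk ((cmBorelTriple L 2 v).restrict (SmoothIrrep.ofChar Ξ hΞ).ρ))
      (Representation.Coinvariants.mk_surjective _)
  haveI : FiniteDimensional ℂ ((cmBorelTriple L 2 v).restrict K.quotientRep).Coinvariants :=
    Module.Finite.of_injective (Representation.jacquetMap (cmBorelTriple L 2 v) eQ.toIntertwiningMap).toLinearMap hinjQ
  have hQ1 : Module.finrank ℂ ((cmBorelTriple L 2 v).restrict K.quotientRep).Coinvariants ≤ 1 :=
    (LinearMap.finrank_le_finrank_of_injective (f := (Representation.jacquetMap (cmBorelTriple L 2 v) eQ.toIntertwiningMap).toLinearMap) hinjQ).trans hC1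
  -- ORIENTATION: `ρ ⁄ K ≅ ℂ_Ξ` has the exponent `wχH₂`
  have hXchar : (SmoothIrrep.ofChar Ξ hΞ).ρ.HasJacquetExponent (cmBorelTriple L 2 v)
      (weylTorusCharPair (conjLocal L (IsCMField.complexConj L) v) (cmLocalForm L 2 v) (cmLocalForm_eq_over L 2 v) 0
        ((torusLocalComponent L (IsCMField.complexConj L) v ξ.η).comp
            (quotConj (conjLocal L (IsCMField.complexConj L) v) (conjLocal_conjLocal_cm L v)) *
          halfModulusChar (UnitaryGroup.LocalRing L v))
        (torusLocalComponent L (IsCMField.complexConj L) v ξ.ψ)) := by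
    rw [SmoothIrrep.ofChar_ρ]
    refine F0P3cStCharTSStOneDim.hasJacquetExponent_twist_trivial_of_character (cmBorelTriple L 2 v) _ _ (fun n hn => ?_) (fun m => ?_)
    · rw [hΞv, F0P3bU2XiSphericalVector.localDet_eq_one_of_mem_N L v hn, map_one, map_one, mul_one]
    · rw [hΞv]
      exact xiTwo_torus_eq_weylChar_mul_rootDelta L v ξ m
  have hX : K.quotientRep.HasJacquetExponent (cmBorelTriple L 2 v)
      (weylTorusCharPair (conjLocal L (IsCMField.complexConj L) v) (cmLocalForm L 2 v) (cmLocalForm_eq_over L 2 v) 0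
        ((torusLocalComponent L (IsCMField.complexConj L) v ξ.η).comp
            (quotConj (conjLocal L (IsCMField.complexConj L) v) (conjLocal_conjLocal_cm L v)) *
          halfModulusChar (UnitaryGroup.LocalRing L v))
        (torusLocalComponent L (IsCMField.complexConj L) v ξ.ψ)) :=
    hXchar.map_of_injective (cmBorelTriple L 2 v) eQ.symm.toIntertwiningMap (IrrClass.jacquetMap_equiv_injective (cmBorelTriple L 2 v) eQ.symm)
  -- the generic orientation lemma (§1b) at `θ₁ = wχH₂`, `θ₂ = χH₂`
  exact nonempty_normalizedJacquet_sub_equiv_of_quotient_exponent (cmBorelTriple L 2 v) hNlim hρ K hQ1 (weylChar_ne_chiH2 L v ξ) h2 ℓ hℓ1 hℓ hq hX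

end Summit.HodgeConjecture.HodgeConjecture.R90.S10

end
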